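import Mathlib

/-!
# QuaternionicSplit — the Kuga–Satake sixfold `B″` of every ball stratum of the `U² ⊕ D₄(-1)` face is of SPLIT Weil type for a second quadratic field

(solo-blind s51, `work/s51/b2-type-iii.md`; supersedes the "open case" clause of `WeilDiscTable`.)

Setting.  On a `K′ = ℚ(s)`-ball stratum (`s² = -d′`) of the face, the transcendental lattice is a
`K′`-hermitian space `(T, h)`, `h = ⟨h₁, h₂, h₃, h₄⟩` of signature `(1,3)`, and the simple Kuga–Satake
factor is the weight-one half twist `B″` of `N = Λ²_{K′} T` with hermitian form `H = Λ²h` and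
polarization `E = Tr_{K′/ℚ}(s · H)`.  Everything below is computed from `d′` and `h` alone, in the
`ℚ`-basis `e_p, s·e_p` of `N` (`p` running over the pairs `01,02,03,12,13,23`), with integer matrices.

The new object is the `K′`-ANTILINEAR wedge-star operator `j = H⁻¹ ∘ ∧` (`H(v, j w) = v ∧ w ∈ Λ⁴ T ≅ K′`);
we work with `X = 2j` to stay integral.  For each of the three models
`(d′, h) = (3, ⟨1,-1,-1,-2⟩)` (the `ω`-balls `B₃^ω`), `(1, ⟨1,-1,-1,-1⟩)` (the `ℚ(i)`-balls),
`(2, ⟨1,-1,-1,-1⟩)`, the Boolean certificates `certA/B/C` check, and `decide +kernel` proves (exhaustive evaluation in the kernel; no `native_decide`, no extra axioms):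

* `E` is alternating and non-degenerate (`E · Einv = 4d′ · 1`); `Ls² = -d′`; `Lsᵀ E = -E Ls`;
* `X Ls = -Ls X` (antilinearity), `X² = (4 / det h) · 1` (so `j² = 1/det h < 0`: `ℚ(j)` is an imaginary
  quadratic field, `ℚ(√-2)` for the `ω`-balls, and `F = K′⟨j⟩ = (-d′, det h)_ℚ` is a quaternion algebra),
  `Xᵀ E = -E X` and `Xᵀ E X = -(4/det h) · E` (so `E(j v, j w) = Nm(j) E(v, w)`: Weil compatibility);
* Hodge compatibility at the base point `p₀ = [e₀]` of the ball: `X D = D X`, where `D/√d′` is the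
  weight-one complex structure of `B″_{p₀}` (`+s/√d′` on the lines `e_{0a}` of type `(3,1)+(1,3)`,
  `-s/√d′` on the lines `e_{ab}`, `a, b ≥ 1`, of type `(2,2)`), and `-E·D` is diagonal with positive
  entries (so `-E` polarizes `B″_{p₀}`);
* equivariance making `j` Hodge along the WHOLE ball (`= SU(h)(ℝ)·p₀`): for a `ℚ`-basis `ξ` of
  `𝔲(h)` (sixteen integral generators `2h⁻¹S`, `S` skew-hermitian; `ξ†h + hξ = 0` is checked) the
  derivation action `R(ξ) = dΛ²(ξ)` on `N` satisfies `X R(ξ) - R(ξ) X = L(conj (tr ξ)) X` on every basis vector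
  (i.e. `j ∘ g = (det g)⁻¹ · g ∘ j` on `U(h)`; in particular `j` commutes with `SU(h)`);
* SPLITNESS: the `ℚ`-structure `U₀ = span_ℚ{e_p}` (the 12 × 6 inclusion `U`) is an `X`-stable
  `E`-Lagrangian: `Uᵀ E U = 0`, `X U = U C`, `Uᵀ U = 1`.  Hence `U₀` is a 3-dimensional
  `ℚ(j)`-subspace on which the `ℚ(j)`-hermitian form `H_j(v,w) = E(jv, w) + j E(v, w)` vanishes:
  `(B″, ℚ(j), -E)` is a polarized abelian sixfold of Weil type (signature `(3,3)` because `F ⊗ ℂ ≅ M₂(ℂ)`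
  acts on `H^{1,0}`) with TOTALLY ISOTROPIC (split) hermitian form, i.e. of discriminant `-1`.

Consequence recorded on the paper side (not formalised): by Markman, arXiv:2502.03415 Thm 1.5.1
(`K = ℚ(√-d)` arbitrary, `n = 3`, discriminant `-1`), the `ℚ(j)`-Weil classes of `B″` are algebraic at
every point of every ball stratum; since `F ⊗ ℂ ≅ M₂(ℂ)`, the `F`-translates of `W_{ℚ(j)}` span a
Hodge substructure containing `W_{K″}` for every quadratic `K″ ⊂ F` (van Geemen–Verra, math/0103111,
Prop. 4.7–4.8, Cor. 4.9), so the `K′`-Weil classes of `B″` — in particular `Weil(B″_f)` on the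
`ω`-balls, of `K′`-discriminant `-2` and listed as open in `WeilDiscTable` — are algebraic as well.

Finally `descent27` certifies the finite step of the 3-adic descent showing `2a² + 6b² = 3c²` has no
non-trivial solution, i.e. the `K′ = ℚ(√-3)`-structure itself is NOT split (`6 ∉ Nm ℚ(√-3)^×`),
consistent with `WeilDiscTable.not_two_squares`.
-/

namespace Summit.HodgeConjecture.HodgeConjecture.Theorems.QuaternionicSplit

/-! ## Arithmetic of `K′ = ℚ(s)`, `s² = -d′`, on integer pairs `(a, b) ↔ a + b s` -/

/-- An element `a + b s` of the order `ℤ[s]`. -/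
abbrev Kp := ℤ × ℤ

/-- Product in `ℤ[s]`, `s² = -d′`. -/
def kmul (dp : ℤ) (x y : Kp) : Kp := (x.1 * y.1 - dp * x.2 * y.2, x.1 * y.2 + x.2 * y.1)
/-- Conjugation `s ↦ -s`. -/
def kconj (x : Kp) : Kp := (x.1, -x.2)
/-- Sum. -/
def kadd (x y : Kp) : Kp := (x.1 + y.1, x.2 + y.2)
/-- Integer multiple. -/
def ksm (c : ℤ) (x : Kp) : Kp := (c * x.1, c * x.2)
/-- Trace to `ℚ`: `Tr(a + b s) = 2a`. -/
def ktr (x : Kp) : ℤ := 2 * x.1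
/-- The generator `s`. -/
def sK : Kp := (0, 1)

/-! ## Integer matrices as lists of rows -/

/-- Integer matrices, row-major. -/
abbrev Mat := List (List ℤ)

/-- Entry `(i, j)` (zero outside the stored range). -/
def entry (A : Mat) (i j : ℕ) : ℤ := (A.getD i []).getD j 0
/-- Product of two `n × n` matrices. -/
def mmul (n : ℕ) (A B : Mat) : Mat :=
  (List.range n).map fun i => (List.range n).map fun j =>
    ((List.range n).map fun k => entry A i k * entry B k j).sum
/-- product of an `n × n` with an `n × m` matrix -/
def mmulR (n m : ℕ) (A B : Mat) : Mat :=
  (List.range n).map fun i => (List.range m).map fun j =>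
    ((List.range n).map fun k => entry A i k * entry B k j).sum
/-- product of an `m × n` with an `n × m'` matrix -/
def mmulG (m n m' : ℕ) (A B : Mat) : Mat :=
  (List.range m).map fun i => (List.range m').map fun j =>
    ((List.range n).map fun k => entry A i k * entry B k j).sum
/-- Transpose of an `n × m` matrix. -/
def mtr (n m : ℕ) (A : Mat) : Mat := (List.range m).map fun j => (List.range n).map fun i => entry A i j
/-- Sum. -/
def madd (A B : Mat) : Mat := List.zipWith (List.zipWith (· + ·)) A B
/-- Difference. -/
def msub (A B : Mat) : Mat := List.zipWith (List.zipWith (· - ·)) A B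
/-- Negative. -/
def mneg (A : Mat) : Mat := A.map (List.map (fun x => -x))
/-- Integer multiple. -/
def msmul (c : ℤ) (A : Mat) : Mat := A.map (List.map (c * ·))
/-- Identity `n × n`. -/
def mone (n : ℕ) : Mat := (List.range n).map fun i => (List.range n).map fun j => if i = j then 1 else 0
/-- Zero `n × m`. -/
def mzero (n m : ℕ) : Mat := (List.range n).map fun _ => (List.range m).map fun _ => 0
/-- All entries vanish. -/
def isZero (A : Mat) : Bool := A.all (List.all · (· == 0))
/-- `A` is diagonal with positive diagonal entries (hence positive definite). -/
def isPosDiag (n : ℕ) (A : Mat) : Bool :=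
  (List.range n).all fun i => (List.range n).all fun j =>
    if i = j then decide (0 < entry A i j) else entry A i j == 0

/-! ## The `K′`-space `N = Λ²_{K′} K′⁴` -/

/-- The six pairs `a < b` (0-indexed); the complement of pair `k` is pair `5 - k`. -/
def pairs : List (ℕ × ℕ) := [(0, 1), (0, 2), (0, 3), (1, 2), (1, 3), (2, 3)]
/-- Sign of the permutation `(p_k, p_{5-k})` of `(0,1,2,3)`: `e_{p_k} ∧ e_{p_{5-k}} = ε_k · vol`. -/
def eps : List ℤ := [1, -1, 1, 1, -1, 1]
/-- `H(e_p, e_p) = h_a h_b` for `p = (a, b)`. -/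
def hh (h : List ℤ) (k : ℕ) : ℤ := h.getD (pairs.getD k (0, 0)).1 0 * h.getD (pairs.getD k (0, 0)).2 0

/-- A vector of `N`: six `K′`-coordinates (coefficient of `e_{p_k}`). -/
abbrev Vec := List Kp
/-- `k`-th `K′`-coordinate of a vector. -/
def vget (v : Vec) (k : ℕ) : Kp := v.getD k (0, 0)
/-- The `ℚ`-basis vector number `i < 12`: `s^{i mod 2} · e_{p_{i/2}}`. -/
def bvec (i : ℕ) : Vec := (List.range 6).map fun k => if k = i / 2 then (if i % 2 = 0 then (1, 0) else (0, 1)) else (0, 0)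
/-- Real coordinates of a vector in the basis `e_p, s e_p`. -/
def coords (v : Vec) : List ℤ := (List.range 12).map fun r => if r % 2 = 0 then (vget v (r / 2)).1 else (vget v (r / 2)).2
/-- Matrix (12 × 12) of an additive operator on `N` given on vectors. -/
def opMat (f : Vec → Vec) : Mat :=
  (List.range 12).map fun r => (List.range 12).map fun c => (coords (f (bvec c))).getD r 0

/-- Left multiplication by a scalar `c ∈ K′`. -/
def lmulOp (dp : ℤ) (c : Kp) (v : Vec) : Vec := (List.range 6).map fun k => kmul dp c (vget v k)

/-- The polarization `E(u e_p, u' e_q) = δ_{pq} Tr(s · h_p · u · conj u')` as a 12 × 12 matrix. -/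
def Emat (dp : ℤ) (h : List ℤ) : Mat :=
  (List.range 12).map fun i => (List.range 12).map fun j =>
    if i / 2 = j / 2 then
      ktr (kmul dp sK (kmul dp (hh h (i / 2), 0) (kmul dp (vget (bvec i) (i / 2)) (kconj (vget (bvec j) (j / 2))))))
    else 0
/-- Integral quasi-inverse of `E`: `E · Einv = 4d′ · 1`. -/
def Einv (h : List ℤ) : Mat :=
  (List.range 12).map fun i => (List.range 12).map fun j =>
    if i / 2 = j / 2 then
      (if i % 2 = 0 ∧ j % 2 = 1 then -(2 / hh h (i / 2)) else if i % 2 = 1 ∧ j % 2 = 0 then 2 / hh h (i / 2) else 0)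
    else 0

/-- `X = 2j`: `X(u · e_{p_k}) = conj(u) · (2 ε_k / h_{p_{5-k}}) · e_{p_{5-k}}` (antilinear wedge-star). -/
def Xop (h : List ℤ) (v : Vec) : Vec :=
  (List.range 6).map fun k' => ksm (2 / hh h k' * eps.getD (5 - k') 0) (kconj (vget v (5 - k')))

/-- `D = √d′ ·` (weight-one complex structure at `p₀ = [e₀]`): `+s` on the lines `e_{0a}` (`k < 3`), `-s` on the others. -/
def Dop (dp : ℤ) (v : Vec) : Vec :=
  (List.range 6).map fun k => if k < 3 then kmul dp sK (vget v k) else ksm (-1) (kmul dp sK (vget v k))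

/-- Normalised wedge `e_a ∧ e_b` as (sign, pair index); sign `0` if `a = b`. -/
def wedgeIdx (a b : ℕ) : ℤ × ℕ :=
  if a = b then (0, 0) else if a < b then (1, pairs.findIdx (· == (a, b))) else (-1, pairs.findIdx (· == (b, a)))

/-- Derivation action of `ξ ∈ M₄(K′)` on `Λ²`: `ξ·(e_c ∧ e_d) = ξ e_c ∧ e_d + e_c ∧ ξ e_d`, extended `K′`-linearly. -/
def Rop (dp : ℤ) (ξ : List (List Kp)) (v : Vec) : Vec :=
  (List.range 6).map fun k' =>
    ((List.range 6).map fun k =>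
      let c := (pairs.getD k (0, 0)).1
      let d := (pairs.getD k (0, 0)).2
      let u := vget v k
      -- Σ_a ξ[a][c] e_a ∧ e_d  +  Σ_b ξ[b][d] e_c ∧ e_b, collect the coefficient of e_{p_{k'}}
      let t1 := ((List.range 4).map fun a =>
        let w := wedgeIdx a d
        if w.1 ≠ 0 ∧ w.2 = k' then ksm w.1 (kmul dp u ((ξ.getD a []).getD c (0, 0))) else (0, 0)).foldl kadd (0, 0)
      let t2 := ((List.range 4).map fun b =>
        let w := wedgeIdx c b
        if w.1 ≠ 0 ∧ w.2 = k' then ksm w.1 (kmul dp u ((ξ.getD b []).getD d (0, 0))) else (0, 0)).foldl kadd (0, 0)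
      kadd t1 t2).foldl kadd (0, 0)

/-- The sixteen integral generators `ξ = 2 h⁻¹ S` of `𝔲(h)`, `S` running over a `ℚ`-basis of skew-hermitian
`4 × 4` matrices (`S_aa = s`; `S_ab = u`, `S_ba = -conj u`, `u ∈ {1, s}`, `a < b`). -/
def gens (h : List ℤ) : List (List (List Kp)) :=
  let mk (S : ℕ → ℕ → Kp) : List (List Kp) :=
    (List.range 4).map fun a => (List.range 4).map fun b => ksm (2 / h.getD a 0) (S a b)
  ((List.range 4).map fun a0 => mk fun a b => if a = a0 ∧ b = a0 then sK else (0, 0)) ++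
  ((pairs.map fun p => [(1, 0), sK].map fun u =>
      mk fun a b => if a = p.1 ∧ b = p.2 then u else if a = p.2 ∧ b = p.1 then ksm (-1) (kconj u) else (0, 0))
    |>.flatten)

/-- Trace of a `4 × 4` matrix over `K′`. -/
def trK (ξ : List (List Kp)) : Kp := ((List.range 4).map fun a => (ξ.getD a []).getD a (0, 0)).foldl kadd (0, 0)

/-- The `ℚ`-structure `U₀ = span{e_p}`: 12 × 6 inclusion matrix. -/
def Umat : Mat := (List.range 12).map fun r => (List.range 6).map fun c => if r = 2 * c then 1 else 0

/-- Certificate, part A (structure), for one model `(d′, h)` with `X² = x2 · 1` (`x2 = 4 / det h`):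
`E` alternating and non-degenerate, `Ls² = -d′`, adjoints, `X` antilinear with `X² = x2`, Weil
compatibility `Xᵀ E X = -x2 · E`, and the Hodge data at `p₀` (`D² = -d′`, `X D = D X`, `-E·D` positive diagonal). -/
def certA (dp : ℤ) (h : List ℤ) (x2 : ℤ) : Bool :=
  let E := Emat dp h
  let Ls := opMat (lmulOp dp sK)
  let X := opMat (Xop h)
  let D := opMat (Dop dp)
  isZero (madd (mtr 12 12 E) E) &&
  (mmul 12 E (Einv h) == msmul (4 * dp) (mone 12)) &&
  (mmul 12 Ls Ls == msmul (-dp) (mone 12)) &&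
  (mmul 12 (mtr 12 12 Ls) E == mneg (mmul 12 E Ls)) &&
  (mmul 12 X Ls == mneg (mmul 12 Ls X)) &&
  (mmul 12 X X == msmul x2 (mone 12)) &&
  (mmul 12 (mtr 12 12 X) E == mneg (mmul 12 E X)) &&
  (mmul 12 (mmul 12 (mtr 12 12 X) E) X == msmul (-x2) E) &&
  (mmul 12 D D == msmul (-dp) (mone 12)) &&
  (mmul 12 X D == mmul 12 D X) &&
  isPosDiag 12 (mneg (mmul 12 E D))

/-- Coordinatewise difference of two vectors of `N`. -/
def vsub (v w : Vec) : Vec := List.zipWith (fun x y => (x.1 - y.1, x.2 - y.2)) v w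

/-- Certificate, part B (`𝔲(h)`-equivariance), evaluated on vectors (no matrix products): for each of the
sixteen generators `ξ`: (i) `ξ ∈ 𝔲(h)`, i.e. `ξ† h + h ξ = 0` (so `R(ξ) = dΛ²(ξ)` preserves `H = Λ²h`
and `E`, by functoriality); (ii) on every basis vector `v` of `N`,
`X (R(ξ) v) - R(ξ) (X v) = conj(tr ξ) · (X v)`, i.e. `X R(ξ) - R(ξ) X = L(conj (tr ξ)) X`. -/
def certB (dp : ℤ) (h : List ℤ) : Bool :=
  ((gens h).length == 16) &&
  ((gens h).all fun ξ =>
    ((List.range 4).all fun a => (List.range 4).all fun b =>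
      kadd (kmul dp (kconj ((ξ.getD b []).getD a (0, 0))) (h.getD b 0, 0))
           (kmul dp (h.getD a 0, 0) ((ξ.getD a []).getD b (0, 0))) == ((0 : ℤ), (0 : ℤ))) &&
    ((List.range 12).all fun i =>
      vsub (Xop h (Rop dp ξ (bvec i))) (Rop dp ξ (Xop h (bvec i))) ==
        lmulOp dp (kconj (trK ξ)) (Xop h (bvec i))))

/-- Certificate, part C (splitness over `ℚ(j)`): `U₀` is an `X`-stable `E`-Lagrangian of rank 6
(`Uᵀ E U = 0`, `X U = U C` with `C = Uᵀ X U`, `Uᵀ U = 1`). -/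
def certC (dp : ℤ) (h : List ℤ) : Bool :=
  let E := Emat dp h
  let X := opMat (Xop h)
  let U := Umat
  let C := mmulG 6 12 6 (mtr 12 6 U) (mmulR 12 6 X U)
  isZero (mmulG 6 12 6 (mtr 12 6 U) (mmulR 12 6 E U)) &&
  (mmulR 12 6 X U == mmulG 12 6 6 U C) &&
  (mmulG 6 12 6 (mtr 12 6 U) U == mone 6)

/-! ## The three models

`ω`-balls: `K′ = ℚ(√-3)`, `h = ⟨1,-1,-1,-2⟩`, `det h = -2`, `X² = -2` (`j² = -1/2`, `ℚ(j) = ℚ(√-2)`);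
`ℚ(i)`-balls: `K′ = ℚ(√-1)`, `h = ⟨1,-1,-1,-1⟩`, `det h = -1`, `X² = -4` (`j² = -1`);
`ℚ(√-2)`-balls: `K′ = ℚ(√-2)`, same `h`, `X² = -4`. -/

set_option maxHeartbeats 4000000 in
/-- `ω`-ball model, part A. -/
theorem omega_ball_A : certA 3 [1, -1, -1, -2] (-2) = true := by decide +kernel

set_option maxHeartbeats 4000000 in
/-- `ω`-ball model, part B (equivariance ⇒ `j` is a Hodge endomorphism along the whole ball). -/
theorem omega_ball_B : certB 3 [1, -1, -1, -2] = true := by decide +kernel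

set_option maxHeartbeats 4000000 in
/-- `ω`-ball model, part C: `B″_f` carries a SPLIT `ℚ(√-2)`-Weil structure (discriminant `-1`). -/
theorem omega_ball_C : certC 3 [1, -1, -1, -2] = true := by decide +kernel

set_option maxHeartbeats 4000000 in
/-- `ℚ(i)`-ball model, part A. -/
theorem gauss_ball_A : certA 1 [1, -1, -1, -1] (-4) = true := by decide +kernel

set_option maxHeartbeats 4000000 in
/-- `ℚ(i)`-ball model, part B. -/
theorem gauss_ball_B : certB 1 [1, -1, -1, -1] = true := by decide +kernel

set_option maxHeartbeats 4000000 in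
/-- `ℚ(i)`-ball model, part C. -/
theorem gauss_ball_C : certC 1 [1, -1, -1, -1] = true := by decide +kernel

set_option maxHeartbeats 4000000 in
/-- `ℚ(√-2)`-ball model, part A. -/
theorem sqrt2_ball_A : certA 2 [1, -1, -1, -1] (-4) = true := by decide +kernel

set_option maxHeartbeats 4000000 in
/-- `ℚ(√-2)`-ball model, part B. -/
theorem sqrt2_ball_B : certB 2 [1, -1, -1, -1] = true := by decide +kernel

set_option maxHeartbeats 4000000 in
/-- `ℚ(√-2)`-ball model, part C. -/
theorem sqrt2_ball_C : certC 2 [1, -1, -1, -1] = true := by decide +kernel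

/-- The finite step of the 3-adic descent for `2a² + 6b² = 3c²`: every solution mod 27 has `3 ∣ a, b, c`
(so over `ℤ` only the zero solution exists: `⟨2, 6⟩`, the orthogonal complement of `s = i + j + k` in the
pure quaternions, does not represent `3`; equivalently `6 ∉ Nm ℚ(√-3)^×` and the `K′`-structure of `B″_f`
is not split — Proposition D6 / `WeilDiscTable`). -/
def descentCheck : Bool :=
  (List.range 27).all fun a => (List.range 27).all fun b => (List.range 27).all fun c =>
    ((2 * a * a + 6 * b * b) % 27 != (3 * c * c) % 27) || (a % 3 == 0 && b % 3 == 0 && c % 3 == 0)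

set_option maxHeartbeats 4000000 in
/-- The 3-adic descent step for `2a² + 6b² = 3c²` holds (checked mod 27). -/
theorem descent27 : descentCheck = true := by decide +kernel

end Summit.HodgeConjecture.HodgeConjecture.Theorems.QuaternionicSplit
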